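import Literature.NumberTheory.EllipticCurves.KummerSelmerStructure
import Literature.NumberTheory.GaloisRepresentations.ContinuousCorestriction
import HarnessLib

/-!
# Kummer classes of local points over a finite layer, in the SUBGROUP model:
# `κ_U(Q) = [τ ↦ τQ - Q] ∈ H¹(U, E[n](K̄)|_U)` for a subgroup `U ≤ Γ_{K_v}` and `Q ∈ E(K̄_v)` with `nQ` fixed by `U`

Topic `NumberTheory/EllipticCurves`; namespace `WeierstrassCurve`. Definitions with bodies and theorems
only: **no named fact is introduced** (D-0026); no instance, no notation.

The tree's local Kummer classes `WeierstrassCurve.localKummerClass` (`KummerSelmerStructure.lean`;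
Silverman, *AEC*, VIII §2 and X §4, the local Kummer sequence `0 → E(K_v)/n → H¹(G_v, E[n]) → …`) live in
`H¹(Γ_E, E[n](K̄)|_{Γ_E})` for a `K`-field `E` (a completion `K_v`): they are the Kummer classes of the
`E`-RATIONAL points. Iwasawa theory at the prime `p` needs the Kummer map of the points over the LAYERS
`K_{n,v} = K_n·K_v` of a `ℤ_p`-extension, `E(K_{n,v}) ⊗ ℚ_p/ℤ_p ↪ H¹(K_{n,v}, E[p^∞])` (Kobayashi, *Invent.
Math.* 152 (2003), §2 p. 4: «we regard `E(K_{n,v}) ⊗ ℚ_p/ℤ_p` as a subgroup of `H¹(K_{n,v}, E[p^∞])` by the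
Kummer map»; (8.23) p. 18: the pairing `( , )_n : H¹(k_n, T) × E(k_n) → ℤ_p` built from it and the cup
product), and the tree models the local layer `K_{n,v}` by the SUBGROUP
`Gal(K̄_v/K_{n,v}) = localSubgroupOfEmb (Γ_n) ι ≤ Γ_{K_v}` (`SubgroupSelmer.lean`, `Kobayashi2003/SignedSelmer.lean`:
`localLayerPointsOfEmb = FixedPoints.addSubgroup (…) (localPoints W E)`), with cohomology
`Hⁿ(U, X) = continuousCohomology n (subgroupRep X U)` (`ContinuousCorestriction.lean`). This file supplies the
Kummer cocycle and class IN THAT MODEL, for an ARBITRARY subgroup `U ≤ Γ_E`: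

* `subgroupKummerCocycle W n hn U Q hQ` — for `Q ∈ E(K̄_E)` with `n • Q` fixed by `U`, the continuous crossed
  homomorphism `U → E[n](K̄)`, `τ ↦ θ⁻¹(τQ - Q)` (`θ = torsionPointsEquiv`, the torsion comparison
  `E[n](K̄) ≃ E(K̄_E)[n]`), and `subgroupKummerClass` — its class in `H¹(U, E[n](K̄)|_U)`;
* additivity in `Q` (`subgroupKummerClass_add`), dependence on `n • Q` only (`…_eq_of_zsmul_eq`), the
  vanishing criterion `κ_U(Q) = 0 ↔ Q ∈ E(K̄_E)^U + E(K̄_E)[n]` (`…_eq_zero_iff`; exactness of the layer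
  Kummer sequence at `E(L)/nE(L)`, `L = K̄_E^U`);
* functoriality: restriction to a smaller subgroup (`resLe_subgroupKummerClass`), restriction of the
  `Γ_E`-level class (`resSubgroup_localKummerClass`), and the CONJUGATION ACTION of `g ∈ Γ_E` on `H¹(U, ·)`
  for `U` normal: `g · κ_U(Q) = κ_U(gQ)` (`conjMap_subgroupKummerClass`; Kobayashi (8.23): «compatible with
  the natural Galois action»);
* change of level on values: `k • κ_{U,kd}(Q)(τ) = κ_{U,d}(kQ)(τ)` (`zsmul_coe_subgroupKummerCocycle`), the
  cocycle identity behind `[k]_* κ_{kd}(Q) = κ_d(kQ)` (Milne, *ADT*, I §6, proof of Prop. 6.9);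
* the Kummer MAP of the layer: `subgroupKummerMap W n hn U : E(K̄_E)^U →+ H¹(U, E[n](K̄)|_U)`, `P ↦ κ_U(Q)` for
  any `Q` with `nQ = P` (`subgroupKummerMap_apply_eq`; divisibility of `E(K̄_E)`), with kernel criterion
  `subgroupKummerMap_eq_zero_iff`.

Consumer: the `T_pE`-adic local Tate pairing at the layers of the cyclotomic tower (crux K3
`SignedKatoDivisibilityUpToAtTwo` of `Summits/BirchSwinnertonDyer`, the (D-layer) definition item of line
`colemanrat`), whose second argument is `Q ↦ κ_{U_n}(Q)`.

## References

* [SilvermanAEC2009] J. H. Silverman, *The Arithmetic of Elliptic Curves*, 2nd ed. (2009), VIII §2 (the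
  Kummer pairing `κ(P, σ) = Q^σ - Q`, Prop. VIII.2.1 (Hilbert 90 step), pp. 190–191), X §4.
* [Kobayashi2003] S. Kobayashi, *Iwasawa theory for elliptic curves at supersingular primes*, Invent.
  Math. 152 (2003), §2 (p. 4), (8.23) (p. 18).
* [MilneADT2006] J. S. Milne, *Arithmetic Duality Theorems*, 2nd ed. (2006), I §6, proof of Prop. 6.9.
* [SerreLocalFields1979] J.-P. Serre, *Local Fields* (1979), VII §5 (the action of `G/H` on `H^q(H, A)`).
-/

noncomputable section

open scoped Classical

universe u

namespace WeierstrassCurve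

open Literature.NumberTheory.EllipticCurves Literature.NumberTheory.GaloisRepresentations Field
open scoped ContRepresentation

variable {K : Type u} [Field K] (W : WeierstrassCurve K) (n : ℤ)
variable {E : Type u} [Field E] [Algebra K E]

/-! ## The Kummer cocycle and class on a subgroup `U ≤ Γ_E` -/

section SubgroupKummer

variable (U : Subgroup (absoluteGaloisGroup E))

variable {W n U} in
/-- For `Q ∈ E(K̄_E)` with `n • Q` fixed by `U` and `τ ∈ U`, the point `τ • Q - Q` is `n`-torsion.
[cite: SilvermanAEC2009, VIII §2 (pp. 190–191)] -/
theorem smul_sub_mem_torsionBy_localPoints_of_mem_fixedPoints {Q : localPoints W E}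
    (hQ : n • Q ∈ FixedPoints.addSubgroup U (localPoints W E)) (τ : U) :
    (τ : absoluteGaloisGroup E) • Q - Q ∈ AddSubgroup.torsionBy (localPoints W E) n := by
  change n • ((τ : absoluteGaloisGroup E) • Q - Q) = 0
  have h : (τ : absoluteGaloisGroup E) • (n • Q) = n • Q := ((FixedPoints.mem_addSubgroup _ _ _).1 hQ) τ
  rw [zsmul_sub, ← smul_zsmul_localPoints, h, sub_self]

section Root

variable [W.IsElliptic] (hn : n ≠ 0)

/-- An `n`-th root in `E(K̄_E)` of a point (divisibility of the points over the algebraically closed field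
`K̄_E`), chosen once. [cite: SilvermanAEC2009, VIII §2 (pp. 190–191)] -/
def subgroupZSMulRoot (P : localPoints W E) : localPoints W E :=
  ((W.baseChange (AlgebraicClosure E)).zsmul_surjective_of_isAlgClosed hn P).choose

/-- `n • (root of P) = P`. [cite: SilvermanAEC2009, VIII §2 (pp. 190–191)] -/
@[simp]
theorem zsmul_subgroupZSMulRoot (P : localPoints W E) : n • W.subgroupZSMulRoot n hn P = P :=
  ((W.baseChange (AlgebraicClosure E)).zsmul_surjective_of_isAlgClosed hn P).choose_spec

end Root

variable [CharZero K] [W.IsElliptic] (hn : n ≠ 0)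

/-- **The Kummer cocycle of a local point over the layer cut out by `U`.** For a subgroup `U ≤ Γ_E`
(`Γ_E = Gal(K̄_E/E)`, `E` a `K`-field) and `Q ∈ E(K̄_E)` with `n • Q ∈ E(K̄_E)^U` (a point rational over the
fixed field `L = K̄_E^U`): `τ ↦ θ⁻¹(τ • Q - Q)`, a continuous crossed homomorphism on `U` with values in the
restricted module `E[n](K̄)|_U` (`θ = torsionPointsEquiv`, the torsion comparison `E[n](K̄) ≃ E(K̄_E)[n]`).
For `U = Γ_E` this is the tree's `localKummerCocycle`. [cite: SilvermanAEC2009, VIII §2 (pp. 190–191)]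
[cite: Kobayashi2003, §2 (p. 4)] -/
def subgroupKummerCocycle (Q : localPoints W E) (hQ : n • Q ∈ FixedPoints.addSubgroup U (localPoints W E)) :
    contOneCocycles
      (subgroupRep (DiscreteGaloisModule.toTopRep (GaloisRep.restrictField E (W.torsionGaloisModule n))) U) :=
  ⟨⟨fun τ => (W.torsionPointsEquiv n (E := E) hn).symm
      ⟨(τ : absoluteGaloisGroup E) • Q - Q, smul_sub_mem_torsionBy_localPoints_of_mem_fixedPoints hQ τ⟩,
    continuous_of_discreteTopology.comp
      ((((continuous_smul_of_isOpen_stabilizer Q (W.isOpen_stabilizer_localPoints E Q)).comp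
        continuous_subtype_val).sub continuous_const).subtype_mk _)⟩,
    fun g h => by
      change (W.torsionPointsEquiv n (E := E) hn).symm ⟨((g * h : U) : absoluteGaloisGroup E) • Q - Q, _⟩ =
        (W.torsionPointsEquiv n (E := E) hn).symm ⟨(g : absoluteGaloisGroup E) • Q - Q, _⟩ +
          absGaloisRestrict K E (g : absoluteGaloisGroup E) •
            (W.torsionPointsEquiv n (E := E) hn).symm ⟨(h : absoluteGaloisGroup E) • Q - Q, _⟩
      rw [← resGal_eq_absGaloisRestrict, ← torsionPointsEquiv_symm_smul, ← map_add]
      congr 1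
      apply Subtype.ext
      change ((g : absoluteGaloisGroup E) * (h : absoluteGaloisGroup E)) • Q - Q =
        ((g : absoluteGaloisGroup E) • Q - Q) + (g : absoluteGaloisGroup E) • ((h : absoluteGaloisGroup E) • Q - Q)
      rw [mul_smul, smul_sub]
      abel⟩

/-- Values of the subgroup Kummer cocycle on underlying points: `pointsMap (κ_U(Q) τ) = τ • Q - Q`.
[cite: SilvermanAEC2009, VIII §2 (pp. 190–191)] -/
@[simp]
theorem pointsMap_subgroupKummerCocycle_apply (Q : localPoints W E)
    (hQ : n • Q ∈ FixedPoints.addSubgroup U (localPoints W E)) (τ : U) :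
    pointsMap W E ((W.subgroupKummerCocycle n U hn Q hQ).1 τ : geomTorsion W n) =
      (τ : absoluteGaloisGroup E) • Q - Q :=
  W.pointsMap_torsionPointsEquiv_symm n hn _

/-- **The Kummer class of a local point over the layer cut out by `U`**:
`κ_U(Q) = [τ ↦ θ⁻¹(τ • Q - Q)] ∈ H¹(U, E[n](K̄)|_U)`, the image of `n • Q ∈ E(L) = E(K̄_E)^U` (`L = K̄_E^U`)
under the Kummer map `E(L)/nE(L) → H¹(L, E[n])` read in the subgroup model `H¹(U, ·)` of `H¹(L, ·)`.
[cite: SilvermanAEC2009, VIII §2 (pp. 190–191)] [cite: Kobayashi2003, §2 (p. 4)] -/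
def subgroupKummerClass (Q : localPoints W E) (hQ : n • Q ∈ FixedPoints.addSubgroup U (localPoints W E)) :
    continuousCohomology 1
      (subgroupRep (DiscreteGaloisModule.toTopRep (GaloisRep.restrictField E (W.torsionGaloisModule n))) U) :=
  oneCocycleClass _ (W.subgroupKummerCocycle n U hn Q hQ)

/-- Additivity of the subgroup Kummer cocycle in `Q`. [cite: SilvermanAEC2009, VIII §2 (pp. 190–191)] -/
theorem subgroupKummerCocycle_add (Q Q' : localPoints W E)
    (hQ : n • Q ∈ FixedPoints.addSubgroup U (localPoints W E))
    (hQ' : n • Q' ∈ FixedPoints.addSubgroup U (localPoints W E))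
    (hQQ' : n • (Q + Q') ∈ FixedPoints.addSubgroup U (localPoints W E)) :
    W.subgroupKummerCocycle n U hn (Q + Q') hQQ' =
      W.subgroupKummerCocycle n U hn Q hQ + W.subgroupKummerCocycle n U hn Q' hQ' := by
  apply Subtype.ext
  ext τ : 1
  change (W.torsionPointsEquiv n (E := E) hn).symm _ =
    (W.torsionPointsEquiv n (E := E) hn).symm _ + (W.torsionPointsEquiv n (E := E) hn).symm _
  rw [← map_add]
  congr 1
  apply Subtype.ext
  change (τ : absoluteGaloisGroup E) • (Q + Q') - (Q + Q') =
    ((τ : absoluteGaloisGroup E) • Q - Q) + ((τ : absoluteGaloisGroup E) • Q' - Q')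
  rw [smul_add]
  abel

/-- Additivity of the subgroup Kummer class in `Q` (the layer Kummer map is a homomorphism).
[cite: SilvermanAEC2009, VIII §2 (pp. 190–191)] -/
theorem subgroupKummerClass_add (Q Q' : localPoints W E)
    (hQ : n • Q ∈ FixedPoints.addSubgroup U (localPoints W E))
    (hQ' : n • Q' ∈ FixedPoints.addSubgroup U (localPoints W E))
    (hQQ' : n • (Q + Q') ∈ FixedPoints.addSubgroup U (localPoints W E)) :
    W.subgroupKummerClass n U hn (Q + Q') hQQ' =
      W.subgroupKummerClass n U hn Q hQ + W.subgroupKummerClass n U hn Q' hQ' := by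
  unfold subgroupKummerClass
  rw [subgroupKummerCocycle_add W n U hn Q Q' hQ hQ', oneCocycleClass_add]

variable {W n U hn} in
/-- Subgroup Kummer classes of equal points are equal (proof-irrelevance helper). [cite: SilvermanAEC2009, VIII §2 (pp. 190–191)] -/
theorem subgroupKummerClass_congr {Q Q' : localPoints W E}
    {hQ : n • Q ∈ FixedPoints.addSubgroup U (localPoints W E)}
    {hQ' : n • Q' ∈ FixedPoints.addSubgroup U (localPoints W E)}
    (h : Q = Q') : W.subgroupKummerClass n U hn Q hQ = W.subgroupKummerClass n U hn Q' hQ' := by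
  subst h; rfl

/-- **Exactness of the layer Kummer sequence at `E(L)/nE(L)`**: `κ_U(Q) = 0` iff `Q` is `U`-fixed up to an
`n`-torsion point (then `n • Q ∈ n · E(L)` up to the image of torsion). [cite: SilvermanAEC2009, VIII §2 (pp. 190–191)] -/
theorem subgroupKummerClass_eq_zero_iff (Q : localPoints W E)
    (hQ : n • Q ∈ FixedPoints.addSubgroup U (localPoints W E)) :
    W.subgroupKummerClass n U hn Q hQ = 0 ↔ ∃ T ∈ AddSubgroup.torsionBy (localPoints W E) n,
      Q - T ∈ FixedPoints.addSubgroup U (localPoints W E) := by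
  refine (oneCocycleClass_eq_zero_iff _ (W.subgroupKummerCocycle n U hn Q hQ)).trans ?_
  constructor
  · rintro ⟨v, hv⟩
    refine ⟨pointsMap W E (v : geomTorsion W n), ?_, (FixedPoints.mem_addSubgroup _ _ _).2 fun τ => ?_⟩
    · change n • pointsMap W E ((v : geomTorsion W n) : geomPoints W) = 0
      rw [← map_zsmul, (mem_geomTorsion_iff W n _).mp v.2, map_zero]
    · have h2 := W.pointsMap_subgroupKummerCocycle_apply n U hn Q hQ τ
      rw [hv τ] at h2
      have h3 : pointsMap W E (((absGaloisRestrict K E (τ : absoluteGaloisGroup E) • v : geomTorsion W n) :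
          geomPoints W) - v) = (τ : absoluteGaloisGroup E) • Q - Q := h2
      rw [map_sub, Literature.NumberTheory.EllipticCurves.AddSubgroup.torsionBy.coe_smul,
        ← resGal_eq_absGaloisRestrict, pointsMap_smul] at h3
      change (τ : absoluteGaloisGroup E) • (Q - pointsMap W E (v : geomTorsion W n)) =
        Q - pointsMap W E (v : geomTorsion W n)
      rw [smul_sub, sub_eq_sub_iff_sub_eq_sub, h3]
  · rintro ⟨T, hT, hfix⟩
    refine ⟨(W.torsionPointsEquiv n (E := E) hn).symm ⟨T, hT⟩, fun τ => ?_⟩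
    apply (W.torsionPointsEquiv n (E := E) hn).injective
    apply Subtype.ext
    change pointsMap W E ((W.subgroupKummerCocycle n U hn Q hQ).1 τ : geomTorsion W n) =
      pointsMap W E (((absGaloisRestrict K E (τ : absoluteGaloisGroup E) •
        (W.torsionPointsEquiv n (E := E) hn).symm ⟨T, hT⟩ : geomTorsion W n) : geomPoints W) -
          (W.torsionPointsEquiv n (E := E) hn).symm ⟨T, hT⟩)
    rw [pointsMap_subgroupKummerCocycle_apply, map_sub,
      Literature.NumberTheory.EllipticCurves.AddSubgroup.torsionBy.coe_smul,
      ← resGal_eq_absGaloisRestrict, pointsMap_smul, pointsMap_torsionPointsEquiv_symm]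
    have h : (τ : absoluteGaloisGroup E) • (Q - T) = Q - T := ((FixedPoints.mem_addSubgroup _ _ _).1 hfix) τ
    rw [smul_sub, sub_eq_sub_iff_sub_eq_sub] at h
    exact h

/-- The subgroup Kummer class of `Q` depends only on `n • Q` (it is a function on `E(L)`).
[cite: SilvermanAEC2009, VIII §2 (pp. 190–191)] -/
theorem subgroupKummerClass_eq_of_zsmul_eq (Q Q' : localPoints W E)
    (hQ : n • Q ∈ FixedPoints.addSubgroup U (localPoints W E))
    (hQ' : n • Q' ∈ FixedPoints.addSubgroup U (localPoints W E))
    (h : n • Q = n • Q') : W.subgroupKummerClass n U hn Q hQ = W.subgroupKummerClass n U hn Q' hQ' := by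
  have hT : Q' - Q ∈ AddSubgroup.torsionBy (localPoints W E) n := by
    change n • (Q' - Q) = 0
    rw [zsmul_sub, h, sub_self]
  have hT' : n • (Q' - Q) ∈ FixedPoints.addSubgroup U (localPoints W E) := by
    have h0 : n • (Q' - Q) = 0 := hT
    rw [h0]
    exact zero_mem _
  have hsum : n • (Q + (Q' - Q)) ∈ FixedPoints.addSubgroup U (localPoints W E) := by
    rw [add_sub_cancel]; exact hQ'
  have hzero : W.subgroupKummerClass n U hn (Q' - Q) hT' = 0 :=
    (W.subgroupKummerClass_eq_zero_iff n U hn _ hT').mpr ⟨Q' - Q, hT, by rw [sub_self]; exact zero_mem _⟩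
  rw [subgroupKummerClass_congr (hQ := hQ') (hQ' := hsum) (add_sub_cancel Q Q').symm,
    W.subgroupKummerClass_add n U hn Q (Q' - Q) hQ hT' hsum, hzero, add_zero]

/-! ## Functoriality: restriction and the conjugation action -/

omit [CharZero K] [W.IsElliptic] in
/-- A point fixed by `U` is fixed by every smaller subgroup (the tower `E(L) ⊆ E(L')` for `L ⊆ L'`).
[cite: Kobayashi2003, Def. 1.1] -/
theorem fixedPoints_addSubgroup_antitone {U U' : Subgroup (absoluteGaloisGroup E)} (hle : U' ≤ U)
    {P : localPoints W E} (hP : P ∈ FixedPoints.addSubgroup U (localPoints W E)) :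
    P ∈ FixedPoints.addSubgroup U' (localPoints W E) :=
  (FixedPoints.mem_addSubgroup _ _ _).2 fun τ => ((FixedPoints.mem_addSubgroup _ _ _).1 hP) ⟨(τ : absoluteGaloisGroup E), hle τ.2⟩

/-- **Restriction to a smaller subgroup**: `res_{U'}^{U} κ_U(Q) = κ_{U'}(Q)` for `U' ≤ U` (the Kummer maps of
the layers `L ⊆ L'` are compatible with restriction). [cite: SilvermanAEC2009, X §4] -/
theorem resLe_subgroupKummerClass {U U' : Subgroup (absoluteGaloisGroup E)} (hle : U' ≤ U) (Q : localPoints W E)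
    (hQ : n • Q ∈ FixedPoints.addSubgroup U (localPoints W E)) :
    resLe (DiscreteGaloisModule.toTopRep (GaloisRep.restrictField E (W.torsionGaloisModule n))) hle 1
        (W.subgroupKummerClass n U hn Q hQ) =
      W.subgroupKummerClass n U' hn Q (W.fixedPoints_addSubgroup_antitone hle hQ) := by
  unfold subgroupKummerClass
  rw [resLe_oneCocycleClass]
  congr 1

/-- **Restriction of the `Γ_E`-level Kummer class**: for `Q` with `n • Q ∈ E(E)` the restriction to `U` of
the tree's `localKummerClass` is `κ_U(Q)`. [cite: SilvermanAEC2009, X §4] -/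
theorem resSubgroup_localKummerClass (Q : localPoints W E)
    (hQ : n • Q ∈ MulAction.fixedPoints (absoluteGaloisGroup E) (localPoints W E))
    (hQU : n • Q ∈ FixedPoints.addSubgroup U (localPoints W E)) :
    resSubgroup (DiscreteGaloisModule.toTopRep (GaloisRep.restrictField E (W.torsionGaloisModule n))) U 1
        (W.localKummerClass n hn Q hQ) =
      W.subgroupKummerClass n U hn Q hQU := by
  unfold localKummerClass subgroupKummerClass
  rw [resSubgroup_oneCocycleClass]
  congr 1

omit [CharZero K] [W.IsElliptic] in
/-- A translate `g • P` of a `U`-fixed point is `U`-fixed when `U` is normal in `Γ_E` (`E(L)` is a `Gal(L/E)`-module).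
[cite: SerreLocalFields1979, VII §5] -/
theorem smul_mem_fixedPoints_addSubgroup_of_normal [U.Normal] (g : absoluteGaloisGroup E) {P : localPoints W E}
    (hP : P ∈ FixedPoints.addSubgroup U (localPoints W E)) :
    g • P ∈ FixedPoints.addSubgroup U (localPoints W E) := by
  refine (FixedPoints.mem_addSubgroup _ _ _).2 fun τ => ?_
  have hmem : g⁻¹ * (τ : absoluteGaloisGroup E) * g ∈ U := by
    have := Subgroup.Normal.conj_mem inferInstance (τ : absoluteGaloisGroup E) τ.2 g⁻¹
    simpa using this
  have h : (g⁻¹ * (τ : absoluteGaloisGroup E) * g) • P = P := ((FixedPoints.mem_addSubgroup _ _ _).1 hP) ⟨_, hmem⟩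
  change (τ : absoluteGaloisGroup E) • g • P = g • P
  calc (τ : absoluteGaloisGroup E) • g • P = g • ((g⁻¹ * (τ : absoluteGaloisGroup E) * g) • P) := by
        rw [mul_smul, mul_smul, smul_inv_smul]
    _ = g • P := by rw [h]

/-- **The conjugation action on layer Kummer cocycles**: for `U` normal in `Γ_E` and `g ∈ Γ_E` the
conjugate cocycle `x ↦ g • κ_U(Q)(g⁻¹ x g)` IS the Kummer cocycle of `g • Q` (an equality of cocycles, not
only of classes). [cite: Kobayashi2003, (8.23) (p. 18)] [cite: SerreLocalFields1979, VII §5] -/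
theorem conj_pullback_subgroupKummerCocycle [U.Normal] (g : absoluteGaloisGroup E) (Q : localPoints W E)
    (hQ : n • Q ∈ FixedPoints.addSubgroup U (localPoints W E)) :
    contOneCocycles.pullback (subgroupConj U g)
        (conjRepHom (DiscreteGaloisModule.toTopRep (GaloisRep.restrictField E (W.torsionGaloisModule n))) U g)
        (W.subgroupKummerCocycle n U hn Q hQ) =
      W.subgroupKummerCocycle n U hn (g • Q)
        (by rw [← smul_zsmul_localPoints]; exact W.smul_mem_fixedPoints_addSubgroup_of_normal U g hQ) := by
  apply Subtype.ext
  ext x : 1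
  rw [conj_pullback_apply]
  apply (W.torsionPointsEquiv n (E := E) hn).injective
  apply Subtype.ext
  change pointsMap W E (((absGaloisRestrict K E g •
      ((W.subgroupKummerCocycle n U hn Q hQ).1 (subgroupConj U g x)) : geomTorsion W n) : geomPoints W)) =
    pointsMap W E ((W.subgroupKummerCocycle n U hn (g • Q) _).1 x : geomTorsion W n)
  rw [Literature.NumberTheory.EllipticCurves.AddSubgroup.torsionBy.coe_smul, ← resGal_eq_absGaloisRestrict,
    pointsMap_smul, pointsMap_subgroupKummerCocycle_apply, pointsMap_subgroupKummerCocycle_apply, smul_sub]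
  change g • ((g⁻¹ * (x : absoluteGaloisGroup E) * g) • Q) - g • Q = (x : absoluteGaloisGroup E) • g • Q - g • Q
  rw [mul_smul, mul_smul, smul_inv_smul]

/-- **The conjugation action on layer Kummer classes**: `g · κ_U(Q) = κ_U(g • Q)` in `H¹(U, E[n](K̄)|_U)` for
`U` normal in `Γ_E` (`conjMap` of `ContinuousCorestriction.lean`; for `U = Gal(K̄_v/K_{n,v})` this is the
`Gal(K_{n,v}/K_v)`-equivariance of the layer Kummer map). [cite: Kobayashi2003, (8.23) (p. 18)]
[cite: SerreLocalFields1979, VII §5] -/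
theorem conjMap_subgroupKummerClass [U.Normal] (g : absoluteGaloisGroup E) (Q : localPoints W E)
    (hQ : n • Q ∈ FixedPoints.addSubgroup U (localPoints W E))
    (hgQ : n • (g • Q) ∈ FixedPoints.addSubgroup U (localPoints W E)) :
    conjMap (DiscreteGaloisModule.toTopRep (GaloisRep.restrictField E (W.torsionGaloisModule n))) U g 1
        (W.subgroupKummerClass n U hn Q hQ) =
      W.subgroupKummerClass n U hn (g • Q) hgQ := by
  unfold subgroupKummerClass
  rw [conjMap_oneCocycleClass, conj_pullback_subgroupKummerCocycle]

/-! ## Change of level on values -/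

/-- **Change of level on values**: `k • κ_{U,kd}(Q)(τ) = κ_{U,d}(k • Q)(τ)` on underlying points of `E(K̄_E)` —
the cocycle identity behind `[k]_* κ_{kd}(Q) = κ_d(kQ)` (the `k`-power map `E[kd] → E[d]` applied to the Kummer
class at level `kd` of a point gives its Kummer class at level `d`). [cite: MilneADT2006, Ch. I §6, proof of Prop. 6.9] -/
theorem zsmul_pointsMap_subgroupKummerCocycle (k d : ℤ) (hkd : k * d ≠ 0) (hd : d ≠ 0) (Q : localPoints W E)
    (hQ : (k * d) • Q ∈ FixedPoints.addSubgroup U (localPoints W E))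
    (hQ' : d • (k • Q) ∈ FixedPoints.addSubgroup U (localPoints W E)) (τ : U) :
    k • pointsMap W E ((W.subgroupKummerCocycle (k * d) U hkd Q hQ).1 τ : geomTorsion W (k * d)) =
      pointsMap W E ((W.subgroupKummerCocycle d U hd (k • Q) hQ').1 τ : geomTorsion W d) := by
  rw [pointsMap_subgroupKummerCocycle_apply, pointsMap_subgroupKummerCocycle_apply, zsmul_sub,
    smul_zsmul_localPoints]

/-- The same in the torsion comparison: `θ_d⁻¹(k • (τQ - Q)) = [k] (κ_{U,kd}(Q)(τ))`, i.e. the value of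
`κ_{U,d}(kQ)` at `τ` is the image of the value of `κ_{U,kd}(Q)` under `torsionMulBy k d : E[kd] → E[d]`.
[cite: MilneADT2006, Ch. I §6, proof of Prop. 6.9] -/
theorem subgroupKummerCocycle_apply_zsmul (k d : ℤ) (hkd : k * d ≠ 0) (hd : d ≠ 0) (Q : localPoints W E)
    (hQ : (k * d) • Q ∈ FixedPoints.addSubgroup U (localPoints W E))
    (hQ' : d • (k • Q) ∈ FixedPoints.addSubgroup U (localPoints W E)) (τ : U) :
    (W.subgroupKummerCocycle d U hd (k • Q) hQ').1 τ =
      W.torsionMulBy k d ((W.subgroupKummerCocycle (k * d) U hkd Q hQ).1 τ) := by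
  have h := W.torsionPointsEquiv_symm_zsmul k d hkd hd
    ⟨(τ : absoluteGaloisGroup E) • Q - Q, smul_sub_mem_torsionBy_localPoints_of_mem_fixedPoints hQ τ⟩
  refine Eq.trans ?_ h
  change (W.torsionPointsEquiv d (E := E) hd).symm ⟨(τ : absoluteGaloisGroup E) • (k • Q) - k • Q, _⟩ =
    (W.torsionPointsEquiv d (E := E) hd).symm _
  congr 1
  apply Subtype.ext
  change (τ : absoluteGaloisGroup E) • (k • Q) - k • Q = k • ((τ : absoluteGaloisGroup E) • Q - Q)
  rw [zsmul_sub, smul_zsmul_localPoints]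

/-! ## The Kummer map of the layer `E(L) → H¹(U, E[n](K̄)|_U)` -/

/-- **The Kummer map of the layer `L = K̄_E^U`**: `E(L) = E(K̄_E)^U →+ H¹(U, E[n](K̄)|_U)`, `P ↦ κ_U(Q)` for any
`Q` with `n • Q = P` (a root chosen by `subgroupZSMulRoot`; independent of the root by
`subgroupKummerClass_eq_of_zsmul_eq`; additive by `subgroupKummerClass_add`).
[cite: SilvermanAEC2009, VIII §2 (pp. 190–191)] [cite: Kobayashi2003, §2 (p. 4)] -/
def subgroupKummerMap :
    FixedPoints.addSubgroup U (localPoints W E) →+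
      continuousCohomology 1
        (subgroupRep (DiscreteGaloisModule.toTopRep (GaloisRep.restrictField E (W.torsionGaloisModule n))) U) :=
  AddMonoidHom.mk'
    (fun P => W.subgroupKummerClass n U hn (W.subgroupZSMulRoot n hn P)
      (by rw [zsmul_subgroupZSMulRoot]; exact P.2))
    (by
      intro P P'
      have hsum : n • (W.subgroupZSMulRoot n hn P + W.subgroupZSMulRoot n hn P') ∈
          FixedPoints.addSubgroup U (localPoints W E) := by
        rw [zsmul_add, zsmul_subgroupZSMulRoot, zsmul_subgroupZSMulRoot]; exact add_mem P.2 P'.2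
      change W.subgroupKummerClass n U hn (W.subgroupZSMulRoot n hn (P + P')) _ =
        W.subgroupKummerClass n U hn (W.subgroupZSMulRoot n hn P) _ +
          W.subgroupKummerClass n U hn (W.subgroupZSMulRoot n hn P') _
      rw [W.subgroupKummerClass_eq_of_zsmul_eq n U hn (W.subgroupZSMulRoot n hn (P + P'))
          (W.subgroupZSMulRoot n hn P + W.subgroupZSMulRoot n hn P') _ hsum
          (by rw [zsmul_add, zsmul_subgroupZSMulRoot, zsmul_subgroupZSMulRoot, zsmul_subgroupZSMulRoot])]
      exact W.subgroupKummerClass_add n U hn _ _ _ _ _)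

/-- The value of the layer Kummer map at `P` is `κ_U(Q)` for ANY `Q` with `n • Q = P`.
[cite: SilvermanAEC2009, VIII §2 (pp. 190–191)] -/
theorem subgroupKummerMap_apply_eq (P : FixedPoints.addSubgroup U (localPoints W E)) (Q : localPoints W E)
    (hQfix : n • Q ∈ FixedPoints.addSubgroup U (localPoints W E)) (hQ : n • Q = P) :
    W.subgroupKummerMap n U hn P = W.subgroupKummerClass n U hn Q hQfix :=
  W.subgroupKummerClass_eq_of_zsmul_eq n U hn _ _ _ _ (by rw [zsmul_subgroupZSMulRoot, hQ])

/-- **Kernel of the layer Kummer map**: `κ_U(P) = 0 ↔ P ∈ n · E(L) + (image of the `U`-fixed torsion)`, in the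
form: some root `Q` of `P` is `U`-fixed up to an `n`-torsion point. [cite: SilvermanAEC2009, VIII §2 (pp. 190–191)] -/
theorem subgroupKummerMap_eq_zero_iff (P : FixedPoints.addSubgroup U (localPoints W E)) :
    W.subgroupKummerMap n U hn P = 0 ↔ ∃ Q : localPoints W E, n • Q = P ∧
      ∃ T ∈ AddSubgroup.torsionBy (localPoints W E) n, Q - T ∈ FixedPoints.addSubgroup U (localPoints W E) := by
  constructor
  · intro h
    refine ⟨W.subgroupZSMulRoot n hn (P : localPoints W E), W.zsmul_subgroupZSMulRoot n hn (P : localPoints W E), ?_⟩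
    exact (W.subgroupKummerClass_eq_zero_iff n U hn _ _).1 h
  · rintro ⟨Q, hQ, T, hT, hfix⟩
    have hQfix : n • Q ∈ FixedPoints.addSubgroup U (localPoints W E) := by rw [hQ]; exact P.2
    rw [W.subgroupKummerMap_apply_eq n U hn P Q hQfix hQ]
    exact (W.subgroupKummerClass_eq_zero_iff n U hn Q hQfix).2 ⟨T, hT, hfix⟩

/-- The layer Kummer map kills `n · E(L)`: `κ_U(n • R) = 0` for `R ∈ E(L)`. [cite: SilvermanAEC2009, VIII §2 (pp. 190–191)] -/
theorem subgroupKummerMap_zsmul (R : FixedPoints.addSubgroup U (localPoints W E)) :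
    W.subgroupKummerMap n U hn (n • R) = 0 :=
  (W.subgroupKummerMap_eq_zero_iff n U hn _).2
    ⟨R, (AddSubgroupClass.coe_zsmul R n).symm, 0, zero_mem _, by rw [sub_zero]; exact R.2⟩

end SubgroupKummer

end WeierstrassCurve
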